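import Summits.ResolutionOfSingularities.ResolutionOfSingularities.Theorems.EquisingularLiftEquisingularLiftNatNDTransportStep
import Summits.ResolutionOfSingularities.ResolutionOfSingularities.Theorems.EquisingularLiftEquisingularLiftNatNDInvPersists
import Summits.ResolutionOfSingularities.ResolutionOfSingularities.Theorems.EquisingularLiftEquisingularLiftNatNDRangeSubscheme
import Summits.ResolutionOfSingularities.ResolutionOfSingularities.Theorems.EquisingularLiftEquisingularLiftNatRegularOfSpecialFibre
import Summits.ResolutionOfSingularities.ResolutionOfSingularities.Theorems.EquisingularLiftCampaignW45bULTSpecialFibrePersists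
import Literature.AlgebraicGeometry.Resolution.EmbeddedCurvePointBlowups
import Literature.AlgebraicGeometry.Resolution.AlterationsNormalFormStrictTransform
import Literature.AlgebraicGeometry.Resolution.RegularBlowup
import Literature.AlgebraicGeometry.Resolution.PointCentrePermissible
import HarnessLib

/-!
# [OURS · L1 W4.5(b) · EL♮(3) · NOSE RESIDUE] POINTS FIRST REGULARISE THE NOSE CURVE — `…NatNosePointsFirst`

OURS · L1 W4.5(b) · EL♮(3) stmt-ResolutionOfSingularities-20148 (parent EL♮ stmt-…-20038) · counted 0 · AI-written (res-L1-w45b-nose-w2 g0, WIDTH seat on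
D-0157 DOOR 1, nose row; desk ANSWER Q-w2 2026-08-28T15:37Z), weaker than expert review; nothing of [Hironaka2017] asserted; no statement of the manuscript;
resolution in positive characteristic is NOT proved here or anywhere in this cell (dimension 3 is Cossart–Piltant 2008/2009 in print). PROVED, def-free, standard
axioms. `--supports stmt-ResolutionOfSingularities-20148 --as helper`.

WHAT (feeds the post-35th re-cut of the nose residue `stub_elnat_three_nonisolated_nonDefNoseTowerBTriplePrime`, branch (B2) of res-L1-w45b-nose-w4's
`nose_residue_singularCurve_trichotomy_three` ✓p644160: «the singular curve `Z` of `H` is itself singular — no nose class can take it; point steps at `Sing Z̃`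
first»). For ANY stage predicate `Q F ρ T` closed under the chains' POINT STEP (the first conjunct of `ND.RoundClosed` p638808 = the point-step blob of
`…NatResidueHypDefs`, VERBATIM: blow up a NON-REGULAR closed point of the reduced closure `T̂` at which the ambient is regular, `T ↦ cl υ⁻¹(T ∖ {x})`), and any
`Q`-stage `(F, ρ, T)` with `F` regular locally Noetherian and `T` closed carrying a closed immersion `i : C ↪ F` of an integral Noetherian quasi-excellent curve with
`i(C) ⊆ T`, `T ⊄ i(C)` and EVERY point of `i(C)` non-regular on `T̂`: finitely many such point steps — at points over `i(Sing C)` only — reach a `Q`-stage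
`(F', π ≫ ρ, T')`, `F'` regular locally Noetherian, `T'` closed, with a closed immersion `i' : C' ↪ F'` of a REGULAR integral curve, proper birational over `C`
(`i' ≫ π = ρC ≫ i`), `i'(C') ⊆ T'`, `T' ⊄ i'(C')`, and again every point of `i'(C')` non-regular on `T̂'` (`exists_pointSteps_regularise_curve`). HONEST SCOPE: this
does NOT decide the class₂ / LIFT(Z′) question of the residue — the liftable classes live in `ℙⁿ_k` only; it moves the nose data one floor up, where the re-cut must
NAME the lift of `Z′`. Mechanism = Liu 9.2.32 (Literature `EmbeddedCurvePointBlowups.exists_embeddedResolution_of_curve`: well-founded induction on `Σ δ`, the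
strict transform of the curve under the ambient point blow-up is its own blow-up at the point), re-run with the point-step bookkeeping: E1-legality from
«every point of the curve is non-regular on `T̂`» + «`F` regular»; persistence of that clause off the centre by `ND.isRegularLocalRing_subscheme_stalk_iff_of_isIso_restrict_compl`
(✓p640760) and over the centre by «regularity generises» (`isRegularLocalRing_stalk_of_specializes`) from the generic point of the strict transform, which is NOT over
the centre; ambient regularity by `IsBlowup.isRegular_of_isRegular_subscheme` + `isRegular_subscheme_vanishingIdeal_singleton`; `i'(C') = cl υ⁻¹(i(C) ∖ {x})`
by `IsBlowup.range_eq_strictTransformSet`.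
-/

set_option linter.dupNamespace false

noncomputable section

open CategoryTheory CategoryTheory.Limits AlgebraicGeometry TopologicalSpace Topology IsLocalRing
open Literature.AlgebraicGeometry.Resolution
open AlgebraicGeometry.Scheme.IdealSheafData

namespace Summit.ResolutionOfSingularities.ResolutionOfSingularities.Cruxes.EquisingularLiftNat.Sections

open Summit.ResolutionOfSingularities.ResolutionOfSingularities.Cruxes.EquisingularLiftNat.Sections.ND

universe u

/-! ## §1 Plumbing -/

/-- Bookkeeping of one point step on a CLOSED `T`: `cl υ⁻¹(T ∖ {x}) ∩ υ⁻¹{x}ᶜ = υ⁻¹(T ∖ {x})`. [folklore] -/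
theorem closure_preimage_diff_singleton_inter_eq {F₁ F₂ : Scheme.{0}} (υ : F₂ ⟶ F₁) {T : Set F₁} (hT : IsClosed T) (x : F₁) :
    closure (υ ⁻¹' (T \ {x})) ∩ υ ⁻¹' {x}ᶜ = υ ⁻¹' (T \ {x}) := by
  ext y
  simp only [Set.mem_inter_iff, Set.mem_preimage, Set.mem_compl_iff, Set.mem_singleton_iff, Set.mem_sdiff]
  constructor
  · rintro ⟨hy, hyx⟩
    have hsub : closure (υ ⁻¹' (T \ {x})) ⊆ υ ⁻¹' T :=
      closure_minimal (Set.preimage_mono Set.sdiff_subset) (hT.preimage υ.continuous)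
    exact ⟨hsub hy, hyx⟩
  · rintro ⟨hyT, hyx⟩
    exact ⟨subset_closure ⟨hyT, hyx⟩, hyx⟩

/-- Points of the reduced closure `T̂` over a point of `cl T`. [folklore] -/
theorem exists_subschemeι_eq_of_mem_closure {F : Scheme.{0}} (T : Set F) {y : F} (hy : y ∈ closure T) :
    ∃ z : ↥(vanishingIdeal (⟨closure T, isClosed_closure⟩ : Closeds F)).subscheme,
      ((vanishingIdeal (⟨closure T, isClosed_closure⟩ : Closeds F)).subschemeι z : F) = y := by
  have h := range_subschemeι_vanishingIdeal_closure T
  rw [Set.ext_iff] at h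
  exact (h y).mpr hy

/-- Non-regularity of the reduced closure `T̂` passes to SPECIALISATIONS inside `T̂` (regularity generises, `isRegularLocalRing_stalk_of_specializes`; the
immersion `T̂ ↪ F` is an embedding, so specialisation can be read in `F`). [folklore] -/
theorem not_isRegularLocalRing_subscheme_stalk_of_specializes {F : Scheme.{0}} (T : Set F)
    (z z' : ↥(vanishingIdeal (⟨closure T, isClosed_closure⟩ : Closeds F)).subscheme)
    (h : ((vanishingIdeal (⟨closure T, isClosed_closure⟩ : Closeds F)).subschemeι z' : F) ⤳
      ((vanishingIdeal (⟨closure T, isClosed_closure⟩ : Closeds F)).subschemeι z : F))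
    (hz' : ¬ IsRegularLocalRing ((vanishingIdeal (⟨closure T, isClosed_closure⟩ : Closeds F)).subscheme.presheaf.stalk z')) :
    ¬ IsRegularLocalRing ((vanishingIdeal (⟨closure T, isClosed_closure⟩ : Closeds F)).subscheme.presheaf.stalk z) := by
  intro hz
  have hsp : z' ⤳ z :=
    ((vanishingIdeal (⟨closure T, isClosed_closure⟩ : Closeds F)).subschemeι.isClosedEmbedding.isInducing.specializes_iff).mp h
  exact hz' (isRegularLocalRing_stalk_of_specializes hsp hz)

/-! ## §2 Points first regularise the curve -/

/-- **POINTS FIRST REGULARISE THE NOSE CURVE** (module docstring), with the `δ`-measure `m = Σ_y δ(𝒪_{C,y})` exposed for the induction.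
[cite: Liu2002, §9.2.4 Lemma 2.32] [OURS · L1 W4.5b · nose residue, branch (B2)] -/
theorem exists_pointSteps_regularise_curve_aux {B : Scheme.{0}} (Q : ∀ F : Scheme.{0}, (F ⟶ B) → Set F → Prop)
    (hQ : ∀ (F₁ F₂ : Scheme.{0}) (ρ : F₁ ⟶ B) (T₁ : Set F₁)
      (x : ↥(vanishingIdeal (⟨closure T₁, isClosed_closure⟩ : Closeds F₁)).subscheme) (υ : F₂ ⟶ F₁)
      (hx : IsClosed ({((vanishingIdeal (⟨closure T₁, isClosed_closure⟩ : Closeds F₁)).subschemeι x : F₁)} : Set F₁)),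
      Q F₁ ρ T₁ →
      ¬ IsRegularLocalRing ((vanishingIdeal (⟨closure T₁, isClosed_closure⟩ : Closeds F₁)).subscheme.presheaf.stalk x) →
      IsRegularLocalRing (F₁.presheaf.stalk ((vanishingIdeal (⟨closure T₁, isClosed_closure⟩ : Closeds F₁)).subschemeι x : F₁)) →
      IsBlowup υ (vanishingIdeal (⟨{((vanishingIdeal (⟨closure T₁, isClosed_closure⟩ : Closeds F₁)).subschemeι x : F₁)}, hx⟩ : Closeds F₁)) →
      Q F₂ (υ ≫ ρ) (closure (υ ⁻¹' (T₁ \ {((vanishingIdeal (⟨closure T₁, isClosed_closure⟩ : Closeds F₁)).subschemeι x : F₁)})))) :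
    ∀ (m : ℕ∞) {F C : Scheme.{0}} (ρ : F ⟶ B) (T : Set F) (i : C ⟶ F) [IsClosedImmersion i] [IsIntegral C] [IsNoetherian C]
      [IsLocallyNoetherian F],
      ∑ᶠ y, pointDelta C y = m → Q F ρ T → Scheme.IsRegular F → IsClosed T → Scheme.IsQuasiExcellent C → topologicalKrullDim C ≤ 1 →
      Set.range i ⊆ T → ¬ T ⊆ Set.range i →
      (∀ z : ↥(vanishingIdeal (⟨closure T, isClosed_closure⟩ : Closeds F)).subscheme,
        ((vanishingIdeal (⟨closure T, isClosed_closure⟩ : Closeds F)).subschemeι z : F) ∈ Set.range i →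
        ¬ IsRegularLocalRing ((vanishingIdeal (⟨closure T, isClosed_closure⟩ : Closeds F)).subscheme.presheaf.stalk z)) →
      ∃ (F' C' : Scheme.{0}) (π : F' ⟶ F) (T' : Set F') (i' : C' ⟶ F') (ρC : C' ⟶ C),
        Q F' (π ≫ ρ) T' ∧ IsLocallyNoetherian F' ∧ Scheme.IsRegular F' ∧ IsClosed T' ∧
        IsPointBlowupComposition (i '' (Scheme.regularLocus C)ᶜ) π ∧
        IsClosedImmersion i' ∧ i' ≫ π = ρC ≫ i ∧ IsIntegral C' ∧ Scheme.IsRegular C' ∧ IsProper ρC ∧ IsBirational ρC ∧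
        topologicalKrullDim C' ≤ 1 ∧ Set.range i' ⊆ T' ∧ ¬ T' ⊆ Set.range i' ∧
        (∀ z : ↥(vanishingIdeal (⟨closure T', isClosed_closure⟩ : Closeds F')).subscheme,
          ((vanishingIdeal (⟨closure T', isClosed_closure⟩ : Closeds F')).subschemeι z : F') ∈ Set.range i' →
          ¬ IsRegularLocalRing ((vanishingIdeal (⟨closure T', isClosed_closure⟩ : Closeds F')).subscheme.presheaf.stalk z)) := by
  intro m
  induction m using WellFoundedLT.induction with
  | _ m ih =>
  intro F C ρ T i _ _ _ _ hm hQF hFreg hTcl hC hdim hCT hTC hCsing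
  classical
  by_cases hreg : Scheme.IsRegular C
  · refine ⟨F, C, 𝟙 F, T, i, 𝟙 C, by simpa using hQF, inferInstance, hFreg, hTcl, IsPointBlowupComposition.nil, inferInstance, by simp,
      inferInstance, hreg, inferInstance, ⟨⊤, by simp [dense_univ], by simp [dense_univ], inferInstance⟩, hdim, hCT, hTC, hCsing⟩
  -- a singular point `c`, closed, with `dim 𝒪_{C,c} = 1`, `𝒪_{C,c}` not a DVR (as in `exists_embeddedResolution_of_curve`)
  obtain ⟨c, hc⟩ : ∃ c, c ∉ Scheme.regularLocus C := not_forall.mp hreg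
  have hcl : IsClosed ({c} : Set C) := isClosed_singleton_of_not_mem_regularLocus_of_dim_le_one hC hdim hc
  obtain ⟨h1, hsing⟩ := ringKrullDim_eq_one_and_not_isDiscreteValuationRing_of_not_mem_regularLocus hdim hc
  have hcf : ¬ IsField (C.presheaf.stalk c) := (ringKrullDim_eq_one_iff_of_isLocalRing_isDomain.mp h1).1
  -- the point `x = i(c)`, read as a point `z₀` of the reduced closure `T̂`
  have hxT : i c ∈ closure T := subset_closure (hCT ⟨c, rfl⟩)
  obtain ⟨z₀, hz₀⟩ := exists_subschemeι_eq_of_mem_closure T hxT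
  set x : F := ((vanishingIdeal (⟨closure T, isClosed_closure⟩ : Closeds F)).subschemeι z₀ : F) with hxdef
  have hcx : i c = x := hz₀.symm
  have hx : IsClosed ({x} : Set F) := by
    rw [← hcx, ← Set.image_singleton]
    exact i.isClosedEmbedding.isClosedMap _ hcl
  have hxne : ({x} : Set F) ≠ Set.univ := by
    intro h
    have hmem : i (genericPoint C) ∈ ({x} : Set F) := h ▸ Set.mem_univ _
    rw [Set.mem_singleton_iff, ← hcx] at hmem
    exact ne_genericPoint_of_not_mem_regularLocus hc (i.isClosedEmbedding.injective hmem).symm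
  -- E1-legality of the point step at `x`
  have hnreg : ¬ IsRegularLocalRing ((vanishingIdeal (⟨closure T, isClosed_closure⟩ : Closeds F)).subscheme.presheaf.stalk z₀) :=
    hCsing z₀ ⟨c, hcx⟩
  have hregx : IsRegularLocalRing (F.presheaf.stalk x) := hFreg x
  -- blow up `F` at `x` (a `Q`-step), and `C` along `i⁻¹𝓘_{x} 𝒪_C` (the strict transform)
  obtain ⟨F₁, υ, hυ⟩ := exists_isBlowup F (vanishingIdeal ⟨{x}, hx⟩)
  have hQ₁ : Q F₁ (υ ≫ ρ) (closure (υ ⁻¹' (T \ {x}))) := hQ F F₁ ρ T z₀ υ hx hQF hnreg hregx hυ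
  obtain ⟨C₁, ρ₁, hρ₁⟩ := exists_isBlowup C ((vanishingIdeal ⟨{x}, hx⟩).comap i)
  haveI : IsIntegral C₁ := hρ₁.isIntegral_strictTransform i hx hcx hcf
  obtain ⟨hN₁, hC₁⟩ := hρ₁.isLocallyNoetherian_and_isQuasiExcellent_strictTransform i hx hC
  haveI := hN₁
  haveI : IsProper ρ₁ := hρ₁.isProper
  haveI : CompactSpace C₁ := QuasiCompact.compactSpace_of_compactSpace ρ₁
  haveI : IsNoetherian C₁ := {}
  have hdim₁ : topologicalKrullDim C₁ ≤ 1 := hρ₁.topologicalKrullDim_le hdim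
  have hlt : ∑ᶠ y, pointDelta C₁ y < m :=
    hm ▸ (hρ₁.finsum_pointDelta_strictTransform_lt i hx hcx hC hdim h1 hsing).2
  have hne₁ : (vanishingIdeal ⟨{x}, hx⟩).comap i ≠ ⊥ := comap_vanishingIdeal_singleton_ne_bot i hx hcx hcf
  -- the strict transform as a closed subscheme of `F₁` (universal property + GW 13.96 (2))
  let j : C₁ ⟶ F₁ := hυ.lift (ρ₁ ≫ i)
    (by rw [Scheme.IdealSheafData.comap_comp]; exact hρ₁.isEffectiveCartier)
  have hj : j ≫ υ = ρ₁ ≫ i := hυ.lift_comp _ _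
  haveI : IsClosedImmersion j := hυ.isClosedImmersion_of_comp_eq hρ₁ hj
  haveI : IsLocallyNoetherian F₁ := hυ.isLocallyNoetherian
  have hF₁reg : Scheme.IsRegular F₁ := hυ.isRegular_of_isRegular_subscheme hFreg (isRegular_subscheme_vanishingIdeal_singleton hx)
  have hjυ : ∀ y' : C₁, υ (j y') = i (ρ₁ y') := fun y' => by
    rw [← Scheme.Hom.comp_apply, hj, Scheme.Hom.comp_apply]
  -- the image of the strict transform is the set-theoretic strict transform of `i(C)`, inside that of `T`
  have hrange : Set.range j = closure (υ ⁻¹' (Set.range i \ {x})) := by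
    rw [hυ.range_eq_strictTransformSet hρ₁ hj j.isClosedEmbedding.isClosed_range, strictTransformSet,
      Scheme.IdealSheafData.coe_support_vanishingIdeal]
    rfl
  have hjT : Set.range j ⊆ closure (υ ⁻¹' (T \ {x})) := by
    rw [hrange]
    exact closure_mono (Set.preimage_mono (Set.sdiff_subset_sdiff_left hCT))
  -- off `x` the step is an isomorphism
  haveI : IsIso (υ ∣_ (⟨{x}ᶜ, hx.isOpen_compl⟩ : F.Opens)) := hυ.isIso_morphismRestrict (by
    rw [Scheme.IdealSheafData.coe_support_vanishingIdeal]
    exact disjoint_compl_left)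
  have hT₁C : ¬ closure (υ ⁻¹' (T \ {x})) ⊆ Set.range j := by
    intro hsub
    obtain ⟨t, htT, htC⟩ := Set.not_subset.mp hTC
    have htx : t ≠ x := fun h => htC ⟨c, by rw [hcx, h]⟩
    obtain ⟨t₁, ht₁⟩ := exists_eq_of_isIso_morphismRestrict υ (⟨{x}ᶜ, hx.isOpen_compl⟩ : F.Opens) (y := t) htx
    have ht₁T : t₁ ∈ closure (υ ⁻¹' (T \ {x})) := subset_closure (by
      rw [Set.mem_preimage, ht₁]
      exact ⟨htT, htx⟩)
    obtain ⟨y', hy'⟩ := hsub ht₁T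
    exact htC ⟨ρ₁ y', by rw [← hjυ, hy', ht₁]⟩
  -- the non-regularity clause one floor up
  have hbook : closure (υ ⁻¹' (T \ {x})) ∩ υ ⁻¹' {x}ᶜ = υ ⁻¹' (T \ {x}) := closure_preimage_diff_singleton_inter_eq υ hTcl x
  have hoff : ∀ z₁ : ↥(vanishingIdeal (⟨closure (closure (υ ⁻¹' (T \ {x}))), isClosed_closure⟩ : Closeds F₁)).subscheme,
      ((vanishingIdeal (⟨closure (closure (υ ⁻¹' (T \ {x}))), isClosed_closure⟩ : Closeds F₁)).subschemeι z₁ : F₁) ∈ Set.range j →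
      υ ((vanishingIdeal (⟨closure (closure (υ ⁻¹' (T \ {x}))), isClosed_closure⟩ : Closeds F₁)).subschemeι z₁) ≠ x →
      ¬ IsRegularLocalRing ((vanishingIdeal (⟨closure (closure (υ ⁻¹' (T \ {x}))), isClosed_closure⟩ : Closeds F₁)).subscheme.presheaf.stalk z₁) := by
    intro z₁ hz₁ hne hreg₁
    obtain ⟨y', hy'⟩ := hz₁
    have hmem : υ ((vanishingIdeal (⟨closure (closure (υ ⁻¹' (T \ {x}))), isClosed_closure⟩ : Closeds F₁)).subschemeι z₁) ∈ Set.range i :=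
      ⟨ρ₁ y', by rw [← hjυ, hy']⟩
    obtain ⟨z, hz⟩ := exists_subschemeι_eq_of_mem_closure T (subset_closure (hCT hmem))
    have h' := (isRegularLocalRing_subscheme_stalk_iff_of_isIso_restrict_compl υ x hx T (closure (υ ⁻¹' (T \ {x}))) isClosed_closure hbook
      _ hne z₁ rfl z hz).mp hreg₁
    exact hCsing z (hz ▸ hmem) h'
  have hCsing₁ : ∀ z₁ : ↥(vanishingIdeal (⟨closure (closure (υ ⁻¹' (T \ {x}))), isClosed_closure⟩ : Closeds F₁)).subscheme,
      ((vanishingIdeal (⟨closure (closure (υ ⁻¹' (T \ {x}))), isClosed_closure⟩ : Closeds F₁)).subschemeι z₁ : F₁) ∈ Set.range j →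
      ¬ IsRegularLocalRing ((vanishingIdeal (⟨closure (closure (υ ⁻¹' (T \ {x}))), isClosed_closure⟩ : Closeds F₁)).subscheme.presheaf.stalk z₁) := by
    intro z₁ hz₁
    by_cases hne : υ ((vanishingIdeal (⟨closure (closure (υ ⁻¹' (T \ {x}))), isClosed_closure⟩ : Closeds F₁)).subschemeι z₁) ≠ x
    · exact hoff z₁ hz₁ hne
    · -- over `x`: specialise from the generic point of the strict transform, which is NOT over `x`
      rw [not_ne_iff] at hne
      have hsurj : Function.Surjective ρ₁ :=
        Summit.ResolutionOfSingularities.ResolutionOfSingularities.Theorems.EquisingularLift.surjective_of_isBlowup hρ₁ hne₁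
      have hηx : υ (j (genericPoint C₁)) ≠ x := by
        intro hη
        obtain ⟨y', hy'⟩ := hsurj (genericPoint C)
        have hsp : υ (j (genericPoint C₁)) ⤳ υ (j y') := ((genericPoint_specializes y').map j.continuous).map υ.continuous
        rw [hη] at hsp
        have hmem : υ (j y') ∈ closure ({x} : Set F) := hsp.mem_closure
        rw [hx.closure_eq, Set.mem_singleton_iff, hjυ, hy', ← hcx] at hmem
        exact ne_genericPoint_of_not_mem_regularLocus hc (i.isClosedEmbedding.injective hmem).symm
      have hηT : j (genericPoint C₁) ∈ closure (closure (υ ⁻¹' (T \ {x}))) := by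
        rw [closure_closure]
        exact hjT ⟨_, rfl⟩
      obtain ⟨zη, hzη⟩ := exists_subschemeι_eq_of_mem_closure (closure (υ ⁻¹' (T \ {x}))) hηT
      have hη' := hoff zη ⟨genericPoint C₁, hzη.symm⟩ (by rw [hzη]; exact hηx)
      obtain ⟨y', hy'⟩ := hz₁
      have hsp : ((vanishingIdeal (⟨closure (closure (υ ⁻¹' (T \ {x}))), isClosed_closure⟩ : Closeds F₁)).subschemeι zη : F₁) ⤳
          ((vanishingIdeal (⟨closure (closure (υ ⁻¹' (T \ {x}))), isClosed_closure⟩ : Closeds F₁)).subschemeι z₁ : F₁) := by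
        rw [hzη, ← hy']
        exact (genericPoint_specializes y').map j.continuous
      exact not_isRegularLocalRing_subscheme_stalk_of_specializes _ z₁ zη hsp hη'
  -- recurse on the strict transform (smaller `Σ δ`)
  obtain ⟨F', C', π', T', i', ρ', hQ', hN', hreg', hT'cl, hπ', hi', hsq, hint, hregC', hρ', hbir', hdim', hCT', hTC', hCsing'⟩ :=
    ih _ hlt (υ ≫ ρ) (closure (υ ⁻¹' (T \ {x}))) j rfl hQ₁ hF₁reg isClosed_closure hC₁ hdim₁ hjT hT₁C hCsing₁
  haveI := hρ'
  refine ⟨F', C', π' ≫ υ, T', i', ρ' ≫ ρ₁, by simpa only [Category.assoc] using hQ', hN', hreg', hT'cl, ?_, hi', ?_, hint, hregC',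
    inferInstance, hbir'.comp (hρ₁.isBirational' hne₁), hdim', hCT', hTC', hCsing'⟩
  · -- the centres lie over singular points of `C`
    have h₁ : IsPointBlowupComposition (i '' (Scheme.regularLocus C)ᶜ) υ :=
      IsPointBlowupComposition.single υ x hx hxne ⟨c, hc, hcx⟩ hυ
    refine h₁.comp ?_ hπ'
    rintro _ ⟨_, ⟨y', hy', rfl⟩, rfl⟩
    refine ⟨ρ₁ y', hρ₁.not_mem_regularLocus_of_strictTransform (support_comap_vanishingIdeal_singleton i hx hcx) hc hy', ?_⟩
    rw [← hjυ]
  · rw [← Category.assoc, hsq, Category.assoc, hj, Category.assoc]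

/-- **POINTS FIRST REGULARISE THE NOSE CURVE** — the statement without the measure (module docstring; honest scope there: it does NOT decide class₂ / LIFT(Z′),
it only moves the nose data one floor up along E1-legal point steps of ANY `Q`-chain). [cite: Liu2002, §9.2.4 Lemma 2.32] [OURS · L1 W4.5b · nose residue (B2)] -/
theorem exists_pointSteps_regularise_curve {B : Scheme.{0}} (Q : ∀ F : Scheme.{0}, (F ⟶ B) → Set F → Prop)
    (hQ : ∀ (F₁ F₂ : Scheme.{0}) (ρ : F₁ ⟶ B) (T₁ : Set F₁)
      (x : ↥(vanishingIdeal (⟨closure T₁, isClosed_closure⟩ : Closeds F₁)).subscheme) (υ : F₂ ⟶ F₁)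
      (hx : IsClosed ({((vanishingIdeal (⟨closure T₁, isClosed_closure⟩ : Closeds F₁)).subschemeι x : F₁)} : Set F₁)),
      Q F₁ ρ T₁ →
      ¬ IsRegularLocalRing ((vanishingIdeal (⟨closure T₁, isClosed_closure⟩ : Closeds F₁)).subscheme.presheaf.stalk x) →
      IsRegularLocalRing (F₁.presheaf.stalk ((vanishingIdeal (⟨closure T₁, isClosed_closure⟩ : Closeds F₁)).subschemeι x : F₁)) →
      IsBlowup υ (vanishingIdeal (⟨{((vanishingIdeal (⟨closure T₁, isClosed_closure⟩ : Closeds F₁)).subschemeι x : F₁)}, hx⟩ : Closeds F₁)) →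
      Q F₂ (υ ≫ ρ) (closure (υ ⁻¹' (T₁ \ {((vanishingIdeal (⟨closure T₁, isClosed_closure⟩ : Closeds F₁)).subschemeι x : F₁)}))))
    {F C : Scheme.{0}} (ρ : F ⟶ B) (T : Set F) (i : C ⟶ F) [IsClosedImmersion i] [IsIntegral C] [IsNoetherian C]
    [IsLocallyNoetherian F] (hQF : Q F ρ T) (hFreg : Scheme.IsRegular F) (hTcl : IsClosed T) (hC : Scheme.IsQuasiExcellent C)
    (hdim : topologicalKrullDim C ≤ 1) (hCT : Set.range i ⊆ T) (hTC : ¬ T ⊆ Set.range i)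
    (hCsing : ∀ z : ↥(vanishingIdeal (⟨closure T, isClosed_closure⟩ : Closeds F)).subscheme,
      ((vanishingIdeal (⟨closure T, isClosed_closure⟩ : Closeds F)).subschemeι z : F) ∈ Set.range i →
      ¬ IsRegularLocalRing ((vanishingIdeal (⟨closure T, isClosed_closure⟩ : Closeds F)).subscheme.presheaf.stalk z)) :
    ∃ (F' C' : Scheme.{0}) (π : F' ⟶ F) (T' : Set F') (i' : C' ⟶ F') (ρC : C' ⟶ C),
      Q F' (π ≫ ρ) T' ∧ IsLocallyNoetherian F' ∧ Scheme.IsRegular F' ∧ IsClosed T' ∧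
      IsPointBlowupComposition (i '' (Scheme.regularLocus C)ᶜ) π ∧
      IsClosedImmersion i' ∧ i' ≫ π = ρC ≫ i ∧ IsIntegral C' ∧ Scheme.IsRegular C' ∧ IsProper ρC ∧ IsBirational ρC ∧
      topologicalKrullDim C' ≤ 1 ∧ Set.range i' ⊆ T' ∧ ¬ T' ⊆ Set.range i' ∧
      (∀ z : ↥(vanishingIdeal (⟨closure T', isClosed_closure⟩ : Closeds F')).subscheme,
        ((vanishingIdeal (⟨closure T', isClosed_closure⟩ : Closeds F')).subschemeι z : F') ∈ Set.range i' →
        ¬ IsRegularLocalRing ((vanishingIdeal (⟨closure T', isClosed_closure⟩ : Closeds F')).subscheme.presheaf.stalk z)) :=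
  exists_pointSteps_regularise_curve_aux Q hQ _ ρ T i rfl hQF hFreg hTcl hC hdim hCT hTC hCsing

/-! ## §3 At the residue's initial stage `(P, 𝟙, ι(H))`: a singular curve `Z ⊆ ι(Sing H)` -/

/-- **POINTS FIRST, AT THE INITIAL STAGE OF THE NOSE RESIDUE.** `ι : H ↪ P` a closed immersion of a reduced scheme into a regular locally Noetherian `P`
(`P = ℙ³_k` in the residue), `Z ⊆ ι(Sing H)` closed with `ι(H) ⊄ Z` whose reduced subscheme `Z̃` is an integral Noetherian quasi-excellent curve (res-L1-w45b-nose-w4's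
singular curves, `exists_singularCurve_three` ✓p643589 / `singularCurve_redSub_facts`), and ANY stage predicate `Q` closed under the chains' point step with
`Q P 𝟙 ι(H)`: finitely many point steps at points over `Sing Z̃` reach a `Q`-stage `(F, π, T)` (`F` regular, `T` closed) carrying a closed immersion `i' : C' ↪ F` of a
REGULAR integral curve, proper birational over `Z̃`, with `i'(C') ⊆ T`, `T ⊄ i'(C')` and every point of `i'(C')` non-regular on `T̂`. Honest scope: class₂ / LIFT of
`i'(C')` is NOT addressed (module docstring). [cite: Liu2002, §9.2.4 Lemma 2.32] [OURS · L1 W4.5b · nose residue (B2)] -/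
theorem exists_pointSteps_regularise_singularCurve {P H : Scheme.{0}} [IsLocallyNoetherian P] (hP : Scheme.IsRegular P)
    (ι : H ⟶ P) [IsClosedImmersion ι] [IsReduced H]
    (Q : ∀ F : Scheme.{0}, (F ⟶ P) → Set F → Prop)
    (hQ : ∀ (F₁ F₂ : Scheme.{0}) (ρ : F₁ ⟶ P) (T₁ : Set F₁)
      (x : ↥(vanishingIdeal (⟨closure T₁, isClosed_closure⟩ : Closeds F₁)).subscheme) (υ : F₂ ⟶ F₁)
      (hx : IsClosed ({((vanishingIdeal (⟨closure T₁, isClosed_closure⟩ : Closeds F₁)).subschemeι x : F₁)} : Set F₁)),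
      Q F₁ ρ T₁ →
      ¬ IsRegularLocalRing ((vanishingIdeal (⟨closure T₁, isClosed_closure⟩ : Closeds F₁)).subscheme.presheaf.stalk x) →
      IsRegularLocalRing (F₁.presheaf.stalk ((vanishingIdeal (⟨closure T₁, isClosed_closure⟩ : Closeds F₁)).subschemeι x : F₁)) →
      IsBlowup υ (vanishingIdeal (⟨{((vanishingIdeal (⟨closure T₁, isClosed_closure⟩ : Closeds F₁)).subschemeι x : F₁)}, hx⟩ : Closeds F₁)) →
      Q F₂ (υ ≫ ρ) (closure (υ ⁻¹' (T₁ \ {((vanishingIdeal (⟨closure T₁, isClosed_closure⟩ : Closeds F₁)).subschemeι x : F₁)}))))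
    (hQ0 : Q P (𝟙 P) (Set.range ι))
    (Z : Set P) (hZ : IsClosed Z) [IsIntegral (vanishingIdeal (⟨Z, hZ⟩ : Closeds P)).subscheme]
    [IsNoetherian (vanishingIdeal (⟨Z, hZ⟩ : Closeds P)).subscheme]
    (hqe : Scheme.IsQuasiExcellent (vanishingIdeal (⟨Z, hZ⟩ : Closeds P)).subscheme)
    (hdim : topologicalKrullDim (vanishingIdeal (⟨Z, hZ⟩ : Closeds P)).subscheme ≤ 1)
    (hZsing : Z ⊆ ι '' {h : H | ¬ IsRegularLocalRing (H.presheaf.stalk h)}) (hPZ : ¬ Set.range ι ⊆ Z) :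
    ∃ (F C' : Scheme.{0}) (π : F ⟶ P) (T : Set F) (i' : C' ⟶ F) (ρC : C' ⟶ (vanishingIdeal (⟨Z, hZ⟩ : Closeds P)).subscheme),
      Q F π T ∧ IsLocallyNoetherian F ∧ Scheme.IsRegular F ∧ IsClosed T ∧
      IsPointBlowupComposition ((vanishingIdeal (⟨Z, hZ⟩ : Closeds P)).subschemeι ''
        (Scheme.regularLocus (vanishingIdeal (⟨Z, hZ⟩ : Closeds P)).subscheme)ᶜ) π ∧
      IsClosedImmersion i' ∧ i' ≫ π = ρC ≫ (vanishingIdeal (⟨Z, hZ⟩ : Closeds P)).subschemeι ∧ IsIntegral C' ∧ Scheme.IsRegular C' ∧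
      IsProper ρC ∧ IsBirational ρC ∧ topologicalKrullDim C' ≤ 1 ∧ Set.range i' ⊆ T ∧ ¬ T ⊆ Set.range i' ∧
      (∀ z : ↥(vanishingIdeal (⟨closure T, isClosed_closure⟩ : Closeds F)).subscheme,
        ((vanishingIdeal (⟨closure T, isClosed_closure⟩ : Closeds F)).subschemeι z : F) ∈ Set.range i' →
        ¬ IsRegularLocalRing ((vanishingIdeal (⟨closure T, isClosed_closure⟩ : Closeds F)).subscheme.presheaf.stalk z)) := by
  have hrangeZ : Set.range (vanishingIdeal (⟨Z, hZ⟩ : Closeds P)).subschemeι = Z := by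
    have h := Scheme.IdealSheafData.range_subschemeι (vanishingIdeal (⟨Z, hZ⟩ : Closeds P))
    rw [Scheme.IdealSheafData.coe_support_vanishingIdeal] at h
    exact h
  have hZι : Z ⊆ Set.range ι := hZsing.trans (Set.image_subset_range _ _)
  have hCT : Set.range (vanishingIdeal (⟨Z, hZ⟩ : Closeds P)).subschemeι ⊆ Set.range ι := by
    rw [hrangeZ]
    exact hZι
  have hTC : ¬ Set.range ι ⊆ Set.range (vanishingIdeal (⟨Z, hZ⟩ : Closeds P)).subschemeι := by
    rw [hrangeZ]
    exact hPZ
  -- every point of `Z` is a non-regular point of the reduced closure of `ι(H)` (`≅ H` over `P`)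
  obtain ⟨e, he⟩ := exists_iso_subscheme_vanishingIdeal_closure_range ι
  have hCsing : ∀ z : ↥(vanishingIdeal (⟨closure (Set.range ι), isClosed_closure⟩ : Closeds P)).subscheme,
      ((vanishingIdeal (⟨closure (Set.range ι), isClosed_closure⟩ : Closeds P)).subschemeι z : P) ∈
        Set.range (vanishingIdeal (⟨Z, hZ⟩ : Closeds P)).subschemeι →
      ¬ IsRegularLocalRing ((vanishingIdeal (⟨closure (Set.range ι), isClosed_closure⟩ : Closeds P)).subscheme.presheaf.stalk z) := by
    intro z hz hreg
    rw [hrangeZ] at hz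
    obtain ⟨h, hh, hhz⟩ := hZsing hz
    have hιz : ι (e.inv z) = ((vanishingIdeal (⟨closure (Set.range ι), isClosed_closure⟩ : Closeds P)).subschemeι z : P) :=
      apply_inv_eq_of_iso_over e he z
    have hh' : e.inv z = h := ι.isClosedEmbedding.injective (hιz.trans hhz.symm)
    exact hh (hh' ▸ (isRegularLocalRing_stalk_iff_of_iso' e z).mp hreg)
  obtain ⟨F, C', π, T, i', ρC, hQF, hN, hreg, hTcl, hπ, hi', hsq, hint, hregC', hρ, hbir, hdim', hCT', hTC', hCsing'⟩ :=
    exists_pointSteps_regularise_curve Q hQ (𝟙 P) (Set.range ι) (vanishingIdeal (⟨Z, hZ⟩ : Closeds P)).subschemeι hQ0 hP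
      ι.isClosedEmbedding.isClosed_range hqe hdim hCT hTC hCsing
  exact ⟨F, C', π, T, i', ρC, by simpa using hQF, hN, hreg, hTcl, hπ, hi', hsq, hint, hregC', hρ, hbir, hdim', hCT', hTC', hCsing'⟩

end Summit.ResolutionOfSingularities.ResolutionOfSingularities.Cruxes.EquisingularLiftNat.Sections

end
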